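import Summits.AtomisticToContinuum.HydrodynamicLimit.Theorems.AnnealedZeroHorizonAnnealedWeakStrongTimeZeroMeanA
import Summits.AtomisticToContinuum.HydrodynamicLimit.Theorems.AnnealedZeroHorizonAnnealedWeakStrongTimeZeroMeanB

/-!
# Crux `AnnealedWeakStrong` (stmt-AtomisticToContinuum-9258), line `registered`: stub S1
`stub_timeZeroMeanConvergence` — mean convergence of the mollified fields at time zero

Registered stub `theorem stub_timeZeroMeanConvergence : Sig.stub_timeZeroMeanConvergence` of the checked
skeleton of the crux `AnnealedZeroHorizon.AnnealedWeakStrong` (lead `prover-line-stmt-AtomisticToContinuum-9258-c1`,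
namespace `…Theorems.AWS`, objects in `Theorems/AnnealedZeroHorizonDefs.lean`). The signature `Sig.…` is declared
here verbatim from the skeleton and then proved.

## Statement

For continuous profiles `a₀, θ₀ > 0`, `u₀` there is `σ₀ > 0` (here `σ₀ = 1/2`: the local Gibbs laws are
probability measures) such that for `0 < σ < σ₀`, every classical hard-sphere Euler solution `(ρ, u, θ)` on
`[0, T)` with `0 < T` and every flow family `Φ`: if at `t = 0` the empirical fields under the local Gibbs laws
converge IN PROBABILITY to `(ρ, ρu, E)(0, ·)` (`TendstoHydroFieldsAt … 0`), then the `k`-mollified fields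
converge IN MEAN (`MeanFieldsCloseAt … 0`): for every `ε > 0` there is `ℓ > 0` such that for every admissible
mollifier `k ∈ Kernel(ℓ)`, eventually in `N`,
`E ∫ (|ρ^k - ρ| + ‖m^k - ρu‖ + |E^k - E|)(0, x) dx ≤ ε`.

## Proof

`Φ_0 = id` a.e. moves everything under the flow-free local Gibbs measure `P_N`; `ofReal ∫ₓ ≤ ∫⁻ₓ ofReal` and
Tonelli put the centre `x` outside. For each centre, the state distance is at most the sum of the five scalar
deviations `|ρ^k(x) - (k∗ρ₀)(x)|`, `|(m^k(x) - (k∗m₀)(x))ₗ|` (`l = 1,2,3`), `|E^k(x) - (k∗E₀)(x)|` plus the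
mollification bias `|(k∗ρ₀)(x) - ρ₀(x)| + ‖(k∗m₀)(x) - m₀(x)‖ + |(k∗E₀)(x) - E₀(x)|`. The bias is `≤ ε/2` once
`ℓ` is below the `ε/6`-moduli of uniform continuity of `ρ₀, m₀ = ρ₀u₀, E₀` (continuous time-`0` slices,
`0 < T`; file A). Each deviation tends to `0` in probability (the hypothesis with the continuous weight
`χ = k(x - ·)`) and has a second moment bounded uniformly in `N` and `x` (Gaussian velocities given the
positions, file B), hence tends to `0` in mean (uniform integrability, file A) and is bounded; bounded
convergence in `x ∈ 𝕋³` finishes.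
-/

noncomputable section

open MeasureTheory Filter Set
open scoped ENNReal Topology

namespace Summit.AtomisticToContinuum.HydrodynamicLimit.Theorems.AWS

open Literature.MathematicalPhysics.KineticTheory Literature.Analysis.FluidPDE

/-! ### The registered signature -/

/-- **S1 — mean convergence at time zero (statics + uniform integrability; size M, provable now).** For
continuous positive profiles and `σ < σ₀(profiles)`: if a classical solution's time-`0` fields are the limit IN
PROBABILITY of the local-Gibbs empirical fields (the crux's hypothesis, `0 < T` so that `t = 0 ∈ [0,T)` and
`Ū(0,·)` is continuous and positive), then the `k`-mollified fields converge to `Ū(0,·)` IN MEAN, `L¹(P ⊗ dx)`, in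
the double limit. Why plausibly true: `|ρ^k| ≤ ‖k‖_∞`, `‖m^k‖ ≤ ‖k‖_∞ (N+1)⁻¹Σ‖vᵢ‖`, `E^k ≤ ‖k‖_∞ (N+1)⁻¹Σ‖vᵢ‖²/2`
and the local Gibbs law has Maxwellian velocities given the positions, so the tested fields are uniformly
integrable; convergence in probability pointwise in `x` + dominated convergence in `x` + continuity of `Ū(0,·)`
(`∫|k * Ū₀ − Ū₀| ≤ ω(ℓ)`). Leans on: `localGibbsLaw`, `canonicalDensity`, the landed `LocalGibbsFineScale` toolbox
(`Theorems/BoxDissipativeWeakStrongLocalGibbsFineScale*.lean`). -/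
def Sig.stub_timeZeroMeanConvergence : Prop :=
  ∀ (a₀ θ₀ : T3 → ℝ) (u₀ : T3 → V3), Continuous a₀ → Continuous θ₀ → Continuous u₀ →
    (∀ x, 0 < a₀ x) → (∀ x, 0 < θ₀ x) →
    ∃ σ₀ : ℝ, 0 < σ₀ ∧ ∀ σ : ℝ, 0 < σ → σ < σ₀ →
      ∀ (T : ℝ) (ρ θ : ℝ → T3 → ℝ) (u : ℝ → T3 → V3), IsHardSphereEulerSolution σ T ρ u θ → 0 < T →
        ∀ Φ : (N : ℕ) → HardSphereFlow (Literature.Analysis.FluidPDE.Torus.geometry (Fin 3)) (hsDiameter σ N) (N + 1),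
          TendstoHydroFieldsAt (fun N => localGibbsLaw σ a₀ u₀ θ₀ N (Φ N)) Φ ρ u θ 0 →
            MeanFieldsCloseAt σ a₀ u₀ θ₀ Φ ρ u θ 0

/-! ### Splitting the state distance through intermediate targets -/

/-- `dist(U, V) ≤ |U₁ - W₁| + ∑ₗ |(U₂ - W₂)ₗ| + |U₃ - W₃| + dist(W, V)` (triangle inequality, and the
Euclidean norm of `ℝ³` is at most the sum of the coordinates' absolute values). -/
theorem stateDist_le_via (U V W : State) :
    stateDist U V ≤ |U.1 - W.1| + (∑ l, |(U.2.1 - W.2.1) l|) + |U.2.2 - W.2.2| + stateDist W V := by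
  unfold stateDist
  have h1 : |U.1 - V.1| ≤ |U.1 - W.1| + |W.1 - V.1| := abs_sub_le _ _ _
  have h2 : ‖U.2.1 - V.2.1‖ ≤ (∑ l, |(U.2.1 - W.2.1) l|) + ‖W.2.1 - V.2.1‖ :=
    (norm_sub_le_norm_sub_add_norm_sub _ _ _).trans (add_le_add (LGFS.norm_le_sum_abs _) le_rfl)
  have h3 : |U.2.2 - V.2.2| ≤ |U.2.2 - W.2.2| + |W.2.2 - V.2.2| := abs_sub_le _ _ _
  linarith

/-- The same splitting for the mollified state of a configuration, in `ℝ≥0∞`. -/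
theorem ofReal_stateDist_mollState_le {n : ℕ} (k : T3 → ℝ) (z : Config n (Fin 3) T3) (x : T3) (V : State)
    (Wr : ℝ) (Wm : V3) (We : ℝ) :
    ENNReal.ofReal (stateDist (mollState k z x) V) ≤
      ENNReal.ofReal |empiricalDensityField z (fun y => k (x - y)) - Wr| +
        (∑ l, ENNReal.ofReal |(empiricalMomentumField z (fun y => k (x - y)) - Wm) l|) +
        ENNReal.ofReal |empiricalEnergyField z (fun y => k (x - y)) - We| +
        ENNReal.ofReal (stateDist (Wr, Wm, We) V) := by
  refine (ENNReal.ofReal_le_ofReal (stateDist_le_via (mollState k z x) V (Wr, Wm, We))).trans (le_of_eq ?_)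
  rw [ENNReal.ofReal_add (by positivity) (stateDist_nonneg _ _), ENNReal.ofReal_add (by positivity) (abs_nonneg _),
    ENNReal.ofReal_add (abs_nonneg _) (Finset.sum_nonneg fun l _ => abs_nonneg _),
    ENNReal.ofReal_sum_of_nonneg fun l _ => abs_nonneg _]
  rfl

/-! ### The stub -/

/-- **S1 `stub_timeZeroMeanConvergence`** (registered stub of crux stmt-AtomisticToContinuum-9258, line
`registered`): mean (`L¹(P ⊗ dx)`) convergence of the mollified fields at `t = 0` from their convergence in
probability. See the module docstring for the proof. -/
theorem stub_timeZeroMeanConvergence : Sig.stub_timeZeroMeanConvergence := by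
  intro a₀ θ₀ u₀ ha hθ hu ha0 hθ0
  refine ⟨1 / 2, by norm_num, ?_⟩
  intro σ _hσ hσ2 T ρ θ u hsol hT Φ hL
  -- continuity of the time-`0` slices (`0 < T`)
  have h0T : (0 : ℝ) ∈ Set.Ico 0 T := ⟨le_rfl, hT⟩
  have hρc : Continuous (ρ 0) := (hsol.smooth_density.isSmooth_slice h0T).continuous
  have huc : Continuous (u 0) := (hsol.smooth_velocity.isSmooth_slice h0T).continuous
  have hθc : Continuous (θ 0) := (hsol.smooth_temperature.isSmooth_slice h0T).continuous
  have hm₀c : Continuous fun y => ρ 0 y • u 0 y := hρc.smul huc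
  have hE₀c : Continuous fun y => totalEnergyDensity (ρ 0 y) (u 0 y) (θ 0 y) := by
    unfold totalEnergyDensity; fun_prop
  haveI hprob : ∀ N, IsProbabilityMeasure (localGibbsMeasure σ a₀ u₀ θ₀ N) := fun N =>
    isProbabilityMeasure_localGibbsMeasure ha hθ hu ha0 hθ0 hσ2.le N
  -- constants of the profiles and of the time-`0` data
  obtain ⟨Θ, -, hΘ⟩ := LGFS.exists_forall_le_of_continuous hθ
  obtain ⟨U, -, hU⟩ := LGFS.exists_forall_le_of_continuous (continuous_norm.comp hu)
  obtain ⟨B, -, hB⟩ := LGFS.exists_forall_le_of_continuous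
    (f := fun y => 2 * 3 * θ₀ y * ‖u₀ y‖ ^ 2 + θ₀ y ^ 2 / 2 * gaussFourthMomentConst (Fin 3)) (by fun_prop)
  obtain ⟨Ee, -, hEe⟩ := exists_forall_abs_le_of_continuous
    (χ := fun y => ‖u₀ y‖ ^ 2 / 2 + 3 / 2 * θ₀ y) (by fun_prop)
  obtain ⟨R, -, hR⟩ := exists_forall_abs_le_of_continuous hρc
  obtain ⟨Rm, -, hRm⟩ := LGFS.exists_forall_le_of_continuous (continuous_norm.comp hm₀c)
  obtain ⟨RE, -, hRE⟩ := exists_forall_abs_le_of_continuous hE₀c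
  -- the radius: `ε/6`-moduli of uniform continuity of `ρ₀, m₀, E₀`
  intro ε hε
  have hε6 : 0 < ε / 6 := by positivity
  obtain ⟨δ₁, hδ₁, hmod₁⟩ := MesoLLN.exists_forall_euclidDist_lt_norm_sub_lt hρc hε6
  obtain ⟨δ₂, hδ₂, hmod₂⟩ := MesoLLN.exists_forall_euclidDist_lt_norm_sub_lt hm₀c hε6
  obtain ⟨δ₃, hδ₃, hmod₃⟩ := MesoLLN.exists_forall_euclidDist_lt_norm_sub_lt hE₀c hε6
  refine ⟨min δ₁ (min δ₂ δ₃), lt_min hδ₁ (lt_min hδ₂ hδ₃), fun k hk => ?_⟩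
  have hk₁ : IsKernel δ₁ k := hk.mono (min_le_left _ _)
  have hk₂ : IsKernel δ₂ k := hk.mono ((min_le_right _ _).trans (min_le_left _ _))
  have hk₃ : IsKernel δ₃ k := hk.mono ((min_le_right _ _).trans (min_le_right _ _))
  obtain ⟨K, -, hK⟩ := hk.exists_le
  -- the mollified targets `k ∗ ρ₀`, `k ∗ m₀`, `k ∗ E₀`
  have hWm_eq : ∀ x, (∫ y, (k (x - y) * ρ 0 y) • u 0 y) = ∫ y, k (x - y) • (ρ 0 y • u 0 y) := fun x =>
    integral_congr_ae (ae_of_all _ fun y => (smul_smul _ _ _).symm)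
  have hWρc : Continuous fun x => ∫ y, k (x - y) * ρ 0 y := by
    simpa only [smul_eq_mul] using hk.continuous_integral_smul hρc
  have hWmc : Continuous fun x => ∫ y, (k (x - y) * ρ 0 y) • u 0 y := by
    simp_rw [hWm_eq]; exact hk.continuous_integral_smul hm₀c
  have hWEc : Continuous fun x => ∫ y, k (x - y) * totalEnergyDensity (ρ 0 y) (u 0 y) (θ 0 y) := by
    simpa only [smul_eq_mul] using hk.continuous_integral_smul hE₀c
  have hWρb : ∀ x, |∫ y, k (x - y) * ρ 0 y| ≤ R := fun x => by
    simpa only [smul_eq_mul, Real.norm_eq_abs] using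
      hk.norm_integral_smul_le (f := ρ 0) (fun y => (Real.norm_eq_abs _).le.trans (hR y)) x
  have hWmb : ∀ x, ‖∫ y, (k (x - y) * ρ 0 y) • u 0 y‖ ≤ Rm := fun x => by
    rw [hWm_eq]; exact hk.norm_integral_smul_le hRm x
  have hWEb : ∀ x, |∫ y, k (x - y) * totalEnergyDensity (ρ 0 y) (u 0 y) (θ 0 y)| ≤ RE := fun x => by
    simpa only [smul_eq_mul, Real.norm_eq_abs] using
      hk.norm_integral_smul_le (f := fun y => totalEnergyDensity (ρ 0 y) (u 0 y) (θ 0 y))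
        (fun y => (Real.norm_eq_abs _).le.trans (hRE y)) x
  -- the mollification bias is at most `ε/2`
  have hbias : ∀ x, stateDist (∫ y, k (x - y) * ρ 0 y, ∫ y, (k (x - y) * ρ 0 y) • u 0 y,
      ∫ y, k (x - y) * totalEnergyDensity (ρ 0 y) (u 0 y) (θ 0 y)) (consState (ρ 0 x) (u 0 x) (θ 0 x)) ≤ ε / 2 := by
    intro x
    have hb1 : |(∫ y, k (x - y) * ρ 0 y) - ρ 0 x| ≤ ε / 6 := by
      simpa only [smul_eq_mul, Real.norm_eq_abs] using
        hk₁.norm_integral_smul_sub_le hρc (fun x y hxy => (hmod₁ x y hxy).le) x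
    have hb2 : ‖(∫ y, (k (x - y) * ρ 0 y) • u 0 y) - ρ 0 x • u 0 x‖ ≤ ε / 6 := by
      rw [hWm_eq]; exact hk₂.norm_integral_smul_sub_le hm₀c (fun x y hxy => (hmod₂ x y hxy).le) x
    have hb3 : |(∫ y, k (x - y) * totalEnergyDensity (ρ 0 y) (u 0 y) (θ 0 y)) -
        totalEnergyDensity (ρ 0 x) (u 0 x) (θ 0 x)| ≤ ε / 6 := by
      simpa only [smul_eq_mul, Real.norm_eq_abs] using
        hk₃.norm_integral_smul_sub_le hE₀c (fun x y hxy => (hmod₃ x y hxy).le) x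
    simp only [stateDist, consState]
    linarith
  -- per-centre mean convergence of the five scalar deviations (file B)
  have hdens := fun x => tendsto_lintegral_density_dev ha hθ hu ha0 hθ0 hσ2.le Φ (hk.continuous_translate x)
    (fun y => hk.2.1 _) (fun y => hK _) (hWρb x) (fun δ hδ => (hL _ (hk.continuous_translate x) δ hδ).1)
  have hmom := fun x => tendsto_lintegral_momCoord_dev ha hθ hu ha0 hθ0 hσ2.le Φ (hk.continuous_translate x)
    (fun y => hk.2.1 _) (fun y => hK _) hΘ hU (hWmb x) (fun δ hδ => (hL _ (hk.continuous_translate x) δ hδ).2.1)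
  have hen := fun x => tendsto_lintegral_energy_dev ha hθ hu ha0 hθ0 hσ2.le Φ (hk.continuous_translate x)
    (fun y => hk.2.1 _) (fun y => hK _) hB hEe (hWEb x) (fun δ hδ => (hL _ (hk.continuous_translate x) δ hδ).2.2)
  -- the per-centre mean deviation `H_N(x)` and its bounded convergence to `0`
  set H : ℕ → T3 → ℝ≥0∞ := fun N x =>
    ∫⁻ z, ENNReal.ofReal |empiricalDensityField z (fun y => k (x - y)) - ∫ y, k (x - y) * ρ 0 y|
        ∂localGibbsMeasure σ a₀ u₀ θ₀ N +
      (∑ l, ∫⁻ z, ENNReal.ofReal |(empiricalMomentumField z (fun y => k (x - y)) -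
        ∫ y, (k (x - y) * ρ 0 y) • u 0 y) l| ∂localGibbsMeasure σ a₀ u₀ θ₀ N) +
      ∫⁻ z, ENNReal.ofReal |empiricalEnergyField z (fun y => k (x - y)) -
        ∫ y, k (x - y) * totalEnergyDensity (ρ 0 y) (u 0 y) (θ 0 y)| ∂localGibbsMeasure σ a₀ u₀ θ₀ N with hH
  have hHlim : ∀ x, Tendsto (fun N => H N x) atTop (𝓝 0) := fun x => by
    have h := ((hdens x).1.add (tendsto_finsetSum Finset.univ fun l _ => (hmom x l).1)).add (hen x).1
    simpa only [Finset.sum_const_zero, add_zero] using h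
  set Btot : ℝ≥0∞ := ENNReal.ofReal (1 + (K + R) ^ 2) +
    (∑ _l : Fin 3, ENNReal.ofReal (1 + (K ^ 2 * Θ + (K * U + Rm) ^ 2))) +
    ENNReal.ofReal (1 + (K ^ 2 * B + (K * Ee + RE) ^ 2)) with hBtot
  have hBtop : Btot ≠ ⊤ := ENNReal.add_ne_top.2 ⟨ENNReal.add_ne_top.2
    ⟨ENNReal.ofReal_ne_top, ENNReal.sum_ne_top.2 fun l _ => ENNReal.ofReal_ne_top⟩, ENNReal.ofReal_ne_top⟩
  have hHle : ∀ N x, H N x ≤ Btot := fun N x =>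
    add_le_add (add_le_add ((hdens x).2 N) (Finset.sum_le_sum fun l _ => (hmom x l).2 N)) ((hen x).2 N)
  have hkj : Measurable fun p : T3 × T3 => k (p.1 - p.2) := hk.measurable_uncurry
  have hcoord : ∀ l : Fin 3, Measurable fun p : V3 => p l := fun l => by fun_prop
  have hHm : ∀ N, Measurable (H N) := by
    intro N
    refine (Measurable.add ?_ (Finset.measurable_sum _ fun l _ => ?_)).add ?_
    · refine Measurable.lintegral_prod_left ?_
      exact (((LGFS.measurable_empiricalDensityField_param (n := N + 1) (k := fun x y => k (x - y)) hkj).sub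
        (hWρc.measurable.comp measurable_snd)).abs).ennreal_ofReal
    · refine Measurable.lintegral_prod_left ?_
      exact ((hcoord l).comp ((LGFS.measurable_empiricalMomentumField_param (n := N + 1)
        (k := fun x y => k (x - y)) hkj).sub (hWmc.measurable.comp measurable_snd))).abs.ennreal_ofReal
    · refine Measurable.lintegral_prod_left ?_
      exact (((LGFS.measurable_empiricalEnergyField_param (n := N + 1) (k := fun x y => k (x - y)) hkj).sub
        (hWEc.measurable.comp measurable_snd)).abs).ennreal_ofReal
  have hT : Tendsto (fun N => ∫⁻ x, H N x) atTop (𝓝 0) :=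
    tendsto_lintegral_zero_of_forall volume hHm hBtop hHle hHlim
  have hev : ∀ᶠ N in atTop, ∫⁻ x, H N x ≤ ENNReal.ofReal (ε / 2) :=
    hT.eventually (ge_mem_nhds (ENNReal.ofReal_pos.2 (by positivity)))
  filter_upwards [hev] with N hN
  -- the estimate at a fixed `N`
  have hx : ∀ x, ∫⁻ z, ENNReal.ofReal (stateDist (mollState k z x) (consState (ρ 0 x) (u 0 x) (θ 0 x)))
      ∂localGibbsMeasure σ a₀ u₀ θ₀ N ≤ H N x + ENNReal.ofReal (ε / 2) := by
    intro x
    have hkxm : Measurable fun y => k (x - y) := (hk.continuous_translate x).measurable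
    have hAm : Measurable fun z : Config (N + 1) (Fin 3) T3 =>
        ENNReal.ofReal |empiricalDensityField z (fun y => k (x - y)) - ∫ y, k (x - y) * ρ 0 y| :=
      ((LGFS.measurable_empiricalDensityField hkxm).sub_const _).abs.ennreal_ofReal
    have hsm : ∀ l, Measurable fun z : Config (N + 1) (Fin 3) T3 => ENNReal.ofReal
        |(empiricalMomentumField z (fun y => k (x - y)) - ∫ y, (k (x - y) * ρ 0 y) • u 0 y) l| := fun l =>
      ((hcoord l).comp ((LGFS.measurable_empiricalMomentumField hkxm).sub_const _)).abs.ennreal_ofReal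
    have hCm : Measurable fun z : Config (N + 1) (Fin 3) T3 => ENNReal.ofReal |empiricalEnergyField z
        (fun y => k (x - y)) - ∫ y, k (x - y) * totalEnergyDensity (ρ 0 y) (u 0 y) (θ 0 y)| :=
      ((LGFS.measurable_empiricalEnergyField hkxm).sub_const _).abs.ennreal_ofReal
    calc ∫⁻ z, ENNReal.ofReal (stateDist (mollState k z x) (consState (ρ 0 x) (u 0 x) (θ 0 x)))
          ∂localGibbsMeasure σ a₀ u₀ θ₀ N
        ≤ ∫⁻ z, (ENNReal.ofReal |empiricalDensityField z (fun y => k (x - y)) - ∫ y, k (x - y) * ρ 0 y| +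
            (∑ l, ENNReal.ofReal |(empiricalMomentumField z (fun y => k (x - y)) -
              ∫ y, (k (x - y) * ρ 0 y) • u 0 y) l|) +
            ENNReal.ofReal |empiricalEnergyField z (fun y => k (x - y)) -
              ∫ y, k (x - y) * totalEnergyDensity (ρ 0 y) (u 0 y) (θ 0 y)| +
            ENNReal.ofReal (stateDist (∫ y, k (x - y) * ρ 0 y, ∫ y, (k (x - y) * ρ 0 y) • u 0 y,
              ∫ y, k (x - y) * totalEnergyDensity (ρ 0 y) (u 0 y) (θ 0 y)) (consState (ρ 0 x) (u 0 x) (θ 0 x))))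
            ∂localGibbsMeasure σ a₀ u₀ θ₀ N :=
          lintegral_mono fun z => ofReal_stateDist_mollState_le k z x _ _ _ _
      _ = H N x + ENNReal.ofReal (stateDist (∫ y, k (x - y) * ρ 0 y, ∫ y, (k (x - y) * ρ 0 y) • u 0 y,
              ∫ y, k (x - y) * totalEnergyDensity (ρ 0 y) (u 0 y) (θ 0 y)) (consState (ρ 0 x) (u 0 x) (θ 0 x))) := by
          rw [lintegral_add_right _ measurable_const, lintegral_const, measure_univ, mul_one,
            lintegral_add_right _ hCm, lintegral_add_left hAm, lintegral_finsetSum _ fun l _ => hsm l]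
      _ ≤ H N x + ENNReal.ofReal (ε / 2) := add_le_add le_rfl (ENNReal.ofReal_le_ofReal (hbias x))
  -- joint measurability in (configuration, centre) for Tonelli
  have hSm : Measurable fun p : Config (N + 1) (Fin 3) T3 × T3 =>
      ENNReal.ofReal (stateDist (mollState k p.1 p.2) (consState (ρ 0 p.2) (u 0 p.2) (θ 0 p.2))) := by
    simp only [stateDist, mollState, consState]
    refine Measurable.ennreal_ofReal ?_
    refine ((((LGFS.measurable_empiricalDensityField_param (k := fun x y => k (x - y)) hkj).sub
      (hρc.measurable.comp measurable_snd)).abs.add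
      ((LGFS.measurable_empiricalMomentumField_param (k := fun x y => k (x - y)) hkj).sub
        ((hρc.measurable.comp measurable_snd).smul (huc.measurable.comp measurable_snd))).norm).add
      ((LGFS.measurable_empiricalEnergyField_param (k := fun x y => k (x - y)) hkj).sub
        (hE₀c.measurable.comp measurable_snd)).abs)
  -- conclusion
  unfold fieldDistObs
  calc ∫⁻ z, ENNReal.ofReal (∫ x, stateDist (mollState k ((Φ N).flow 0 z) x) (consState (ρ 0 x) (u 0 x) (θ 0 x)))
        ∂localGibbsLaw σ a₀ u₀ θ₀ N (Φ N)
      = ∫⁻ z, ENNReal.ofReal (∫ x, stateDist (mollState k z x) (consState (ρ 0 x) (u 0 x) (θ 0 x)))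
          ∂localGibbsMeasure σ a₀ u₀ θ₀ N :=
        LGFS.lintegral_comp_flow_zero σ N (Φ N)
          (fun z => ENNReal.ofReal (∫ x, stateDist (mollState k z x) (consState (ρ 0 x) (u 0 x) (θ 0 x))))
    _ ≤ ∫⁻ z, ∫⁻ x, ENNReal.ofReal (stateDist (mollState k z x) (consState (ρ 0 x) (u 0 x) (θ 0 x)))
          ∂volume ∂localGibbsMeasure σ a₀ u₀ θ₀ N :=
        lintegral_mono fun z => LGFS.ofReal_integral_le_lintegral_ofReal' fun x => stateDist_nonneg _ _
    _ = ∫⁻ x, ∫⁻ z, ENNReal.ofReal (stateDist (mollState k z x) (consState (ρ 0 x) (u 0 x) (θ 0 x)))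
          ∂localGibbsMeasure σ a₀ u₀ θ₀ N ∂volume := lintegral_lintegral_swap hSm.aemeasurable
    _ ≤ ∫⁻ x, (H N x + ENNReal.ofReal (ε / 2)) ∂volume := lintegral_mono hx
    _ = (∫⁻ x, H N x ∂volume) + ENNReal.ofReal (ε / 2) := by
        rw [lintegral_add_right _ measurable_const, lintegral_const, measure_univ, mul_one]
    _ ≤ ENNReal.ofReal (ε / 2) + ENNReal.ofReal (ε / 2) := add_le_add hN le_rfl
    _ = ENNReal.ofReal ε := by
        rw [← ENNReal.ofReal_add (by positivity) (by positivity)]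
        congr 1
        ring

end Summit.AtomisticToContinuum.HydrodynamicLimit.Theorems.AWS

end
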